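import Summits.HodgeConjecture.HodgeConjecture.Theorems.HodgeLocusCensusLinearCycleRank
import Literature.AlgebraicGeometry.Movasati2017.PeriodMatrixRankLowerBound
import HarnessLib

/-!
# HodgeLocusCensusMovasatiBound — every census matrix with a non-zero period vector has rank ≥ C(n/2+d,d) − (n/2+1)²
# (cell pub-hlocus, lit-g17 bridge; Movasati 2017 GMCD Thm. 2 / §3.5 Props. 7–8 as the Literature theorem
# `Literature.AlgebraicGeometry.Movasati2017.movasati_rank_periodMatrix_ge`, p229945)
HONEST FRAMING: certified instances and evidence bearing on the general Hodge conjecture; no claim.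

For `n` even and `d ≥ 2 + 4/n` (`n + 2 ≤ (n/2)·d`): for every rational combination `δ` of linear cycles of the Fermat
variety `X^n_d`, every characteristic-zero field `K` and every `ζ ∈ K` at which the census period vector
`periodComb n d ζ δ` does not vanish identically on Movasati's box `I_{(n/2+1)(d−2)}`, the census matrix
`ivhsMatrix n d ζ δ = [p_{i+j}(δ)]` has rank at least `C(n/2+d, d) − (n/2+1)²` — Movasati's bound for ALL local Hodge
loci through the Fermat point (the minimum, attained by the single linear cycles: `ivhsRankEq_linearCycle`). Hence every
certified census rank `r` of a row with a visibly non-zero period vector satisfies `r ≥ C(n/2+d,d) − (n/2+1)²`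
(TARGETS T6: `6` for `(4,4)`, `4` for `(6,3)`, `19` for `(4,6)`, `20` for `(10,3)`), by theorem rather than by inspection.
-/

namespace Summit.HodgeConjecture.HodgeConjecture.HodgeLocus.Census

open Literature.AlgebraicGeometry

/-- The census period vector of `δ` is the Literature `combPeriod` of the corresponding list of (coefficient, twist,
pairing) triples (same formula, entry by entry). -/
theorem periodComb_eq_combPeriod {K : Type*} [Field K] (n d : ℕ) (ζ : K) (δ : List (ℚ × LinearCycle n))
    (i : Fin (n + 2) → ℕ) :
    periodComb n d ζ δ i =
      MovasatiVillaflor2018.combPeriod n d ζ (δ.map fun x => ((x.1 : K), x.2.a, x.2.b)) i := by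
  simp only [periodComb, MovasatiVillaflor2018.combPeriod, List.map_map, period_eq_linearCyclePeriod,
    Function.comp_def]

/-- **Movasati's bound for every census matrix**: `n` even, `n + 2 ≤ (n/2)·d`, and the period vector of `δ` non-zero
somewhere on the box `I_{(n/2+1)(d−2)}` at `ζ` ⟹ `rank (ivhsMatrix n d ζ δ) ≥ C(n/2+d, d) − (n/2+1)²`. -/
theorem movasatiBound_le_rank_ivhsMatrix {K : Type*} [Field K] {n d : ℕ} (hn : Even n) (hN : n + 2 ≤ n / 2 * d)
    (ζ : K) (δ : List (ℚ × LinearCycle n))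
    (hne : ∃ i ∈ Movasati2016.indexSet (n + 2) d ((n / 2 + 1) * (d - 2)), periodComb n d ζ δ i ≠ 0) :
    (n / 2 + d).choose d - (n / 2 + 1) ^ 2 ≤ (ivhsMatrix n d ζ δ).rank := by
  rw [ivhsMatrix_eq_periodMatrix]
  have hd : 2 ≤ d := by
    by_contra h
    have : n / 2 * d ≤ n / 2 * 1 := Nat.mul_le_mul_left _ (by omega)
    omega
  refine Movasati2017.movasati_rank_periodMatrix_ge hn hN _
    (fun i hi => MovasatiVillaflor2018.combPeriod_eq_zero_of_le ζ hn hd _ hi) ?_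
  obtain ⟨i, hi, hpi⟩ := hne
  exact ⟨i, hi, by rwa [periodComb_eq_combPeriod] at hpi⟩

/-- **Every census ROW is bounded below by Movasati's number**: if `IvhsRankEq n d r δ` holds and the period vector of
`δ` is non-zero on the box over SOME characteristic-zero field with a primitive `2d`-th root of unity `ζ`, then
`r ≥ C(n/2+d, d) − (n/2+1)²`. -/
theorem IvhsRankEq.movasatiBound_le {n d r : ℕ} {δ : List (ℚ × LinearCycle n)} (h : IvhsRankEq n d r δ)
    (hn : Even n) (hN : n + 2 ≤ n / 2 * d) (K : Type) [Field K] [CharZero K] (ζ : K) (hζ : IsPrimitiveRoot ζ (2 * d))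
    (hne : ∃ i ∈ Movasati2016.indexSet (n + 2) d ((n / 2 + 1) * (d - 2)), periodComb n d ζ δ i ≠ 0) :
    (n / 2 + d).choose d - (n / 2 + 1) ^ 2 ≤ r := by
  rw [← h K ζ hζ]
  exact movasatiBound_le_rank_ivhsMatrix hn hN ζ δ hne

/-- The single linear cycles attain the bound (already `ivhsRankEq_linearCycle`); in particular their period vectors are
non-zero on the box, so the hypothesis of `IvhsRankEq.movasatiBound_le` is met by every row containing them with a
coefficient pattern that does not cancel — e.g. the standard cycle `P` itself: -/
theorem periodComb_standardP_ne_zero {K : Type*} [Field K] {n d : ℕ} (hn : Even n) (hd : 2 ≤ d) {ζ : K} (hζ : ζ ≠ 0)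
    {c : ℚ} (hc : (c : K) ≠ 0) :
    ∃ i ∈ Movasati2016.indexSet (n + 2) d ((n / 2 + 1) * (d - 2)), periodComb n d ζ [(c, standardP n)] i ≠ 0 := by
  obtain ⟨i, hi, hpi⟩ := Movasati2017.exists_linearCyclePeriod_ne_zero (K := K) hn hd hζ
  refine ⟨i, hi, ?_⟩
  rw [periodComb_eq_combPeriod]
  simpa [MovasatiVillaflor2018.combPeriod, standardP] using mul_ne_zero hc hpi

end Summit.HodgeConjecture.HodgeConjecture.HodgeLocus.Census
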